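import Mathlib
import Summits.ValiantsHypothesis.ValiantsHypothesis.Theorems.GrenetZeonDualUnipotentThreeHalvesWordDefs
import Summits.ValiantsHypothesis.ValiantsHypothesis.Theorems.GrenetZeonDualUnipotentThreeHalvesSlowCoreDefs

/-!
# Newton pricing of the POWER currency (val-idea-27 g6, lens (b) «representation-theoretic / weight argument»;
# crux `GrenetZeon.DualUnipotentThreeHalves` = stmt-ValiantsHypothesis-24318; bears on R2ᵖ `HeavyTopSlowLaw` / `Slow` / `SlowR` of LINE `slow_core`)

HONEST FRAMING.  `VP ≠ VNP` is NOT proved; 24318, S3, R2ᵖ, IRR, RED are OPEN.  This scratch file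
* PROVES (kernel, §1) the GAUGE IDENTITY `(A + s·[C,A])^L = (1 + sC)·A^L·(1 − sC)` for `C² = 0`, `CAC = 0` — the simplest
  CANCELLATION SPECIES: an orbital direction is slow with `s`-degree ≤ 2 at EVERY power although its words do not vanish;
* DEFINES (§2) the NEWTON SUPPORT `powSupport N L` of a linear pencil (exponents of the monomials of `(Σ_σ x_σ N_σ)^L`, i.e. the
  contents `γ` whose SYMMETRISED word `Σ_{content(w)=γ} N_{w₁}⋯N_{w_L}` is non-zero) and the two budgets of a COORDINATE direction set `S`
  (`CoordBudgetLE` = power currency along `K_S`, `NewtonBudgetLE` = `max_{γ ∈ supp} |γ|_S`), and STATES the coordinate lemma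
  `stub_coordBudget_iff` (they coincide — no cancellation across distinct `(γ, γ|_S)`);
* STATES (§3, crux format) the TORUS REDUCTION `TorusReduction` (Borel fixed point / initial-subspace degeneration on the Fano variety of
  the slow cone: for a pencil homogeneous under a FINE one-parameter torus, a slow plane may be taken COORDINATE) and the crux-format
  coordinate lemma `stub_slowOn_coord_iff`, and PROVES from the two stubs the headline `slow_iff_newton`:
  for fine torus-homogeneous linear pencils, `Slow n m N` (verbatim `SlowCoreLine.Slow`) ⟺ the Newton polytope of `N(x)^{n−1}` is AVOIDABLE
  (`∃ S k, (k+1)·n < |S| ∧ every support monomial has S-degree ≤ k`).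
`sorry` occurs ONLY in `stub_coordBudget_iff`, `stub_slowOn_coord_iff`, `stub_torusReduction`.
rev 2 (val-idea-27 g7, on val-port-2 g3 23:16:12Z / crit-7 g3 23:15:43Z): `Slow` is now ✓ p677282 `Theorems.…SlowCoreDefs`'s `SlowCore.Slow` BY NAME (import), the
verbatim copy is gone; the W(m) gauge species is priced as a typed ROW in the sibling workfile `GaugeRow.lean` (crit-7 V27 §3 row r4).  VP≠VNP NOT proved.
-/

set_option linter.dupNamespace false
set_option autoImplicit false

noncomputable section

namespace Summit.ValiantsHypothesis.ValiantsHypothesis.Cruxes.DualUnipotentThreeHalves.NewtonPrice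

open MvPolynomial Matrix
open scoped BigOperators
open Summit.ValiantsHypothesis.ValiantsHypothesis.Cruxes.TwoDimCoefficients.DimTwoCases (AffMat IsAffine)
open Summit.ValiantsHypothesis.ValiantsHypothesis.Theorems.GrenetZeon.RadicalSplit (lineSubst linPart)
open Summit.ValiantsHypothesis.ValiantsHypothesis.Theorems.GrenetZeon.SlowCore (Slow)

/-! ## §1 Gauge calibration (kernel): an orbital direction `[C,A]`, `C² = 0 = CAC`, is slow with budget 2 at every power -/

section Gauge

variable {R : Type*} [CommRing R] {m : ℕ}

/-- `X² = 0 ⇒ (1 − X)(1 + X) = 1`. -/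
theorem one_sub_mul_one_add_of_sq (X : Matrix (Fin m) (Fin m) R) (h : X * X = 0) : (1 - X) * (1 + X) = 1 := by
  calc (1 - X) * (1 + X) = 1 - X * X := by noncomm_ring
    _ = 1 := by rw [h, sub_zero]

/-- `X² = 0 ⇒ (1 + X)(1 − X) = 1`. -/
theorem one_add_mul_one_sub_of_sq (X : Matrix (Fin m) (Fin m) R) (h : X * X = 0) : (1 + X) * (1 - X) = 1 := by
  calc (1 + X) * (1 - X) = 1 - X * X := by noncomm_ring
    _ = 1 := by rw [h, sub_zero]

/-- `XAX = 0 ⇒ (1 + X)·A·(1 − X) = A + (XA − AX)`. -/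
theorem conj_eq_add_comm_of (A X : Matrix (Fin m) (Fin m) R) (h : X * A * X = 0) :
    (1 + X) * A * (1 - X) = A + (X * A - A * X) := by
  calc (1 + X) * A * (1 - X) = A + (X * A - A * X) - X * A * X := by noncomm_ring
    _ = A + (X * A - A * X) := by rw [h, sub_zero]

/-- Powers of a two-sided-invertible conjugate. [folklore] -/
theorem conj_pow (A X Y : Matrix (Fin m) (Fin m) R) (hXY : X * Y = 1) (hYX : Y * X = 1) :
    ∀ L : ℕ, (X * A * Y) ^ L = X * A ^ L * Y
  | 0 => by rw [pow_zero, pow_zero, mul_one, hXY]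
  | L + 1 => by
      rw [pow_succ, conj_pow A X Y hXY hYX L, pow_succ]
      calc X * A ^ L * Y * (X * A * Y) = X * A ^ L * (Y * X) * A * Y := by noncomm_ring
        _ = X * (A ^ L * A) * Y := by rw [hYX]; noncomm_ring

theorem smul_sq_eq_zero (C : Matrix (Fin m) (Fin m) R) (hC : C * C = 0) (s : R) : (s • C) * (s • C) = 0 := by
  rw [smul_mul_assoc, mul_smul_comm, hC, smul_zero, smul_zero]

theorem smul_mul_mul_smul_eq_zero (A C : Matrix (Fin m) (Fin m) R) (hCAC : C * A * C = 0) (s : R) :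
    (s • C) * A * (s • C) = 0 := by
  rw [smul_mul_assoc, smul_mul_assoc, mul_smul_comm, hCAC, smul_zero, smul_zero]

/-- The pencil `A + s·[C,A]` is a GAUGE transform of `A` when `CAC = 0`. [folklore] -/
theorem gauge_conj (A C : Matrix (Fin m) (Fin m) R) (hCAC : C * A * C = 0) (s : R) :
    (1 + s • C) * A * (1 - s • C) = A + s • (C * A - A * C) := by
  rw [conj_eq_add_comm_of A (s • C) (smul_mul_mul_smul_eq_zero A C hCAC s), smul_mul_assoc, mul_smul_comm, smul_sub]

/-- ★ **GAUGE IDENTITY.**  `C² = 0`, `CAC = 0` ⇒ `(A + s·[C,A])^L = (1 + sC)·A^L·(1 − sC)` for every `L`: along an orbital direction every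
power is conjugate (by an `s`-affine unit with `s`-affine inverse) to a constant, so its entries have `s`-degree `≤ 2` uniformly in `L` —
although the individual words in `A` and `[C,A]` need not vanish (cancellation species; e.g. idea-29 g4's orbit cones `ℂJ ⊕ [𝔲,J]`).
[folklore; this development] -/
theorem gauge_pow (A C : Matrix (Fin m) (Fin m) R) (hC : C * C = 0) (hCAC : C * A * C = 0) (s : R) (L : ℕ) :
    (A + s • (C * A - A * C)) ^ L = (1 + s • C) * A ^ L * (1 - s • C) := by
  rw [← gauge_conj A C hCAC s]
  exact conj_pow A (1 + s • C) (1 - s • C) (one_add_mul_one_sub_of_sq (s • C) (smul_sq_eq_zero C hC s))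
    (one_sub_mul_one_add_of_sq (s • C) (smul_sq_eq_zero C hC s)) L

end Gauge

/-! ## §2 Newton support and the two budgets of a coordinate direction set -/

section Newton

variable {ι : Type*} [Fintype ι] [DecidableEq ι] {m : ℕ}

/-- The generic linear pencil `Σ_σ x_σ · N_σ` over `ℂ[x_σ : σ ∈ ι]`. -/
def genericPencil (N : ι → Matrix (Fin m) (Fin m) ℂ) : Matrix (Fin m) (Fin m) (MvPolynomial ι ℂ) :=
  ∑ σ, (MvPolynomial.X σ : MvPolynomial ι ℂ) • (N σ).map MvPolynomial.C

/-- NEWTON SUPPORT of the `L`-th power: the exponents `γ` (contents, `|γ| = L`) of the monomials of the entries of `(Σ x_σ N_σ)^L`,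
i.e. those whose SYMMETRISED word `Σ_{content(w) = γ} N_{w₁}⋯N_{w_L}` is non-zero.  (Individual words may be non-zero while `γ ∉ powSupport`.) -/
def powSupport (N : ι → Matrix (Fin m) (Fin m) ℂ) (L : ℕ) : Set (ι →₀ ℕ) :=
  {γ | ∃ i j : Fin m, MvPolynomial.coeff γ ((genericPencil N ^ L) i j) ≠ 0}

/-- NEWTON BUDGET of the coordinate set `S` at power `L` is `≤ k`: every support monomial has `S`-degree `≤ k`
(the support function of the Newton polytope in direction `𝟙_S`). -/
def NewtonBudgetLE (N : ι → Matrix (Fin m) (Fin m) ℂ) (L : ℕ) (S : Finset ι) (k : ℕ) : Prop :=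
  ∀ γ ∈ powSupport N L, ∑ σ ∈ S, γ σ ≤ k

/-- The line pencil `A(a) + s·B(b)` with the direction `B(b) = Σ_{σ ∈ S} b_σ N_σ` supported on the coordinates `S`, over `ℂ[s]`. -/
def linePencil (N : ι → Matrix (Fin m) (Fin m) ℂ) (S : Finset ι) (a b : ι → ℂ) : Matrix (Fin m) (Fin m) (Polynomial ℂ) :=
  ∑ σ, (Polynomial.C (a σ) + if σ ∈ S then Polynomial.C (b σ) * Polynomial.X else 0) • (N σ).map Polynomial.C

/-- POWER BUDGET of the coordinate subspace `K_S` at power `L` is `≤ k`: along every line `A + sB`, `B ∈ K_S`, every entry of `(A + sB)^L`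
has `s`-degree `≤ k`. -/
def CoordBudgetLE (N : ι → Matrix (Fin m) (Fin m) ℂ) (L : ℕ) (S : Finset ι) (k : ℕ) : Prop :=
  ∀ (a b : ι → ℂ) (i j : Fin m), ((linePencil N S a b ^ L) i j).natDegree ≤ k

/-- STUB — ★ **COORDINATE LEMMA** (power budget = Newton budget on coordinate subspaces).  Proof on paper: with `c_σ = a_σ + s·b_σ·[σ ∈ S]`,
`(Σ c_σ N_σ)^L = Σ_γ SW_γ · Π_σ c_σ^{γ_σ}`, and the monomials `a^{γ−β} b^{β} s^{|β|}` (`β ≤ γ|_S`) are pairwise distinct, so the `s`-degree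
as a polynomial identity in `(a, b)` is `max {|γ|_S : SW_γ ≠ 0}` — cancellation can only happen INSIDE a symmetrisation class. [this development] -/
theorem stub_coordBudget_iff (N : ι → Matrix (Fin m) (Fin m) ℂ) (L : ℕ) (S : Finset ι) (k : ℕ) :
    CoordBudgetLE N L S k ↔ NewtonBudgetLE N L S k := by
  sorry

end Newton

/-! ## §3 Crux format: torus reduction and the headline `Slow ⟺ Newton-avoidable` for fine torus-homogeneous pencils -/

section CruxFormat

variable {n m : ℕ}

-- rev 2: `Slow n m N` is ✓ p677282 `SlowCore.Slow` (imported BY NAME; = LINE `slow_core`'s `SlowCoreLine.Slow` verbatim).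

/-- `SlowOn n m N K k` — the first conjunct of `Slow` for a GIVEN direction space `K` and order `k`. -/
def SlowOn (n m : ℕ) (N : AffMat n m) (K : Submodule ℂ (Fin n × Fin n → ℂ)) (k : ℕ) : Prop :=
  ∀ x v : Fin n × Fin n → ℂ, v ∈ K → ∀ i j : Fin m, (((N.map (lineSubst x v)) ^ (n - 1)) i j).totalDegree ≤ k

theorem slow_iff_exists_slowOn (N : AffMat n m) :
    Slow n m N ↔ ∃ (K : Submodule ℂ (Fin n × Fin n → ℂ)) (k : ℕ), SlowOn n m N K k ∧ (k + 1) * n < Module.finrank ℂ K :=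
  Iff.rfl

/-- The pencil is HOMOGENEOUS under the one-parameter torus `t ↦ (diag t^{w σ} on the source, diag t^{ρ i} on ℂ^m)`:
`N_lin(e_σ)` maps `ρ`-degree `d` to `d + w σ` (entrywise: `N_lin(e_σ) i j ≠ 0 ⇒ ρ i = ρ j + w σ`). -/
def OnePSHomogeneous (N : AffMat n m) (w : Fin n × Fin n → ℤ) (ρ : Fin m → ℤ) : Prop :=
  ∀ (σ : Fin n × Fin n) (i j : Fin m), linPart N (Pi.single σ 1) i j ≠ 0 → ρ i = ρ j + w σ

/-- The coordinate subspace `K_S = span {e_σ : σ ∈ S}` of the source `ℂ^{n×n}`. -/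
def coordSubspace (n : ℕ) (S : Finset (Fin n × Fin n)) : Submodule ℂ (Fin n × Fin n → ℂ) :=
  Submodule.span ℂ (Set.range fun σ : (S : Set (Fin n × Fin n)) => (Pi.single (σ : Fin n × Fin n) (1 : ℂ) : Fin n × Fin n → ℂ))

theorem finrank_coordSubspace (n : ℕ) (S : Finset (Fin n × Fin n)) :
    Module.finrank ℂ (coordSubspace n S) = S.card := by
  have hli : LinearIndependent ℂ
      (fun σ : (S : Set (Fin n × Fin n)) => (Pi.single (σ : Fin n × Fin n) (1 : ℂ) : Fin n × Fin n → ℂ)) := by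
    have h0 := (Pi.basisFun ℂ (Fin n × Fin n)).linearIndependent
    have h1 := h0.comp (fun σ : (S : Set (Fin n × Fin n)) => (σ : Fin n × Fin n)) Subtype.val_injective
    convert h1 using 1
    funext σ
    simp [Pi.basisFun_apply]
  rw [coordSubspace, finrank_span_eq_card hli]
  simp

/-- **TORUS REDUCTION** (fine one-parameter case; a `Prop`, the target of `stub_torusReduction`).  For a LINEAR pencil homogeneous under a
one-parameter torus whose source weights `w` are pairwise distinct, a slow plane of order `k` may be replaced by a COORDINATE one of the same
dimension.  Paper proof: the slow cone `Z_k = {v : ∀ x, deg_s N(x + s v)^{n−1} ≤ k}` is Zariski-closed and torus-stable, so the Fano variety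
`{K ≤ Z_k, dim K = d}` is a closed torus-stable subvariety of the Grassmannian; the limit `lim_{t→0} t·K` (the INITIAL subspace of `K` for the
weight order, a coordinate subspace since the weights are distinct, of the same dimension) lies in it (equivalently: Borel's fixed point theorem).
[Borel 1956; Gröbner degeneration; this development] -/
def TorusReduction : Prop :=
  ∀ (n m : ℕ) (N : AffMat n m) (w : Fin n × Fin n → ℤ) (ρ : Fin m → ℤ),
    (∀ i j, (N i j).IsHomogeneous 1) → Function.Injective w → OnePSHomogeneous N w ρ →
    ∀ (K : Submodule ℂ (Fin n × Fin n → ℂ)) (k : ℕ), SlowOn n m N K k →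
      ∃ S : Finset (Fin n × Fin n), S.card = Module.finrank ℂ K ∧ SlowOn n m N (coordSubspace n S) k

/-- STUB — torus reduction (size M as a formalisation: Zariski-closedness of the slow cone + degeneration to the initial subspace). -/
theorem stub_torusReduction : TorusReduction := by
  sorry

/-- STUB — the coordinate lemma in the crux's format (`lineSubst`, `totalDegree`, power `n − 1`): along the coordinate plane `K_S` the power
budget of a LINEAR pencil is the Newton budget of `S` for the colours `N_σ := N_lin(e_σ)`. [this development] -/
theorem stub_slowOn_coord_iff (N : AffMat n m) (hN : ∀ i j, (N i j).IsHomogeneous 1) (S : Finset (Fin n × Fin n)) (k : ℕ) :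
    SlowOn n m N (coordSubspace n S) k ↔ NewtonBudgetLE (fun σ => linPart N (Pi.single σ 1)) (n - 1) S k := by
  sorry

/-- ★ **HEADLINE (kernel from the two stubs): `Slow ⟺ Newton-avoidable`** for LINEAR pencils homogeneous under a FINE one-parameter torus.
The power-currency verdict of LINE `slow_core` on such a pencil is a statement about the Newton polytope of `N(x)^{n−1}` alone:
`Slow n m N ⟺ ∃ S k, (k+1)·n < |S| ∧ every support monomial of N(x)^{n−1} has S-degree ≤ k`. -/
theorem slow_iff_newton (hT : TorusReduction) (N : AffMat n m) (hN : ∀ i j, (N i j).IsHomogeneous 1)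
    (w : Fin n × Fin n → ℤ) (ρ : Fin m → ℤ) (hw : Function.Injective w) (hρ : OnePSHomogeneous N w ρ) :
    Slow n m N ↔ ∃ (S : Finset (Fin n × Fin n)) (k : ℕ),
      NewtonBudgetLE (fun σ => linPart N (Pi.single σ 1)) (n - 1) S k ∧ (k + 1) * n < S.card := by
  rw [slow_iff_exists_slowOn]
  constructor
  · rintro ⟨K, k, hK, hdim⟩
    obtain ⟨S, hcard, hS⟩ := hT n m N w ρ hN hw hρ K k hK
    exact ⟨S, k, (stub_slowOn_coord_iff N hN S k).1 hS, hcard ▸ hdim⟩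
  · rintro ⟨S, k, hS, hdim⟩
    exact ⟨coordSubspace n S, k, (stub_slowOn_coord_iff N hN S k).2 hS, (finrank_coordSubspace n S).symm ▸ hdim⟩

end CruxFormat

end Summit.ValiantsHypothesis.ValiantsHypothesis.Cruxes.DualUnipotentThreeHalves.NewtonPrice

end
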